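/- Copyright: the b2b-balaban cell (near-miss cell 7), T⁴-continuum fan-out, ROUND-2 swarm `t4-ne7b-formalise-*`
(leaf 03, answering the row owner's INTERFACE REQUEST NE7b IR-41-4 addressed to leaf 08, first refusal honoured on the
journal), row NE7b (node U5c COUNT member).  Released under the licence of the surrounding project. -/
import Summits.QuantumFields.BalabanUV.T4Continuum.Support.HistoryRealiseWeakReading
import Summits.QuantumFields.BalabanUV.T4Continuum.Support.HistoryRealisePrintCells

/-!
# Memory-agnostic DOMAIN carriers: `RealisedDomainsW` ∕ `RealisedDomainsRW`, and the root-cell fields discharged for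
them (INTERFACE REQUEST NE7b IR-41-4, file 3 of 3; repair route R-41-a of R-OWNER-41-1)

Summits-side support leaf of the T⁴-continuum cell (rung (B)+1 on a FINITE torus only; NOT infinite volume, NOT the
mass gap, NOT the Clay statement; NOT a proof of the spine estimate NE7b, which is the cell's OWN estimate, NOT PRINTED
and NOT PROVED).  The row owner's INTERFACE REQUEST NE7b IR-41-4 (`HOME/INBOX.md` block «from b2b-balaban-t4-ne7b-p1
gen 41», `CLAIMS.log` l.27257; claim l.27561): the W-twin of row S1b-P2 part 3 `HistoryRealisePrintCells` (leaf-08,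
p247022) over the owner's memory-agnostic core `HistoryRealiseWeak` (p248661); files 1–2 = `HistoryRealiseWeakTimed`,
`HistoryRealiseWeakReading`.

WHY.  The class-R binder `realised` of the headline witness (`WALL-NE7b-P1.md` §2) is `HistoryRealiseCellsRun.RealisedDomainsR`
∕ `HistoryRealiseCells.RealisedDomains` (leaf-08) and their print-exact twins `HistoryRealisePrintCells.RealisedDomainsP` ∕
`RealisedDomainsRP`: the live structures read as realised pending pedigrees WITH THEIR DOMAINS, the two root-cell fields
then DISCHARGED.  Their geometric field `real` asks `Realises …` resp. `RealisesP …`, whose RENEWAL clause reads condition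
(ii)'s memory FROZEN at the line's last event (the owner's located MODEL finding #3, R-OWNER-41-1; print reads the
CURRENT level's `R_j`: B16 = [Balaban1989LargeFieldII] p. 384, B15 = [Balaban1989LargeFieldI] pp. 177, 198 — manuscripts
UNDER AUDIT, locators only).  Repair route R-41-a (design rule: the END must not depend on the readiness CONVENTION at
all): THIS FILE carries the MEMORY-AGNOSTIC TWINS `RealisedDomainsW` ∕ `RealisedDomainsRW` (`real := RealisesW … ∧
PendingBefore … K`, every other field token for token) and re-derives the discharges for them: the root-cell fields need
of `real` only `rootStep ≤ lastStep ≤ K` (`adm_of_realisesW` + `PendingBefore`'s `lastStep ≤ K`), so `cell_mem`∕`cell_inj`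
go through VERBATIM (`cornerCell_mem_cellN`, `coarse_eq_of_cornerCell_eq`, `Qfrom_eq_pow_levelOf_sub_of_le`,
`anchorAt_mem_curDomain` + `track` + `disjoint`), the root-cell maps `cellOfA`∕`cellOfR` are REUSED (they do not mention
the predicate), and the run-profile side conditions come from the flow as before (`runProfile_succ_le`,
`dropCtl_runProfile`).  Output: file 2's `RealisedReadingW`∕`RealisedReadingRW`, hence `TermReadingLE` — so M4 (owner,
R-OWNER-41-5: `real` output in the W-form) can target `RealisedDomainsRW` and row S12-W (IR-41-5) re-plugs the ENDs by
name.  The landed and the print-exact carriers IMPLY the memory-agnostic ones (`RealisedDomains.toW`, `RealisedDomainsR.toW`,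
`RealisedDomainsP.toW`, `RealisedDomainsRP.toW`).  Append-only: nothing landed is edited.

WHAT.  §1 **`structure RealisedDomainsW`**, **`structure RealisedDomainsRW`**, `.toW` ×4, `RealisedDomainsRW.of_const`∕
`to_const`, `rootStep_le_of_realW`.  §2 `cellOfR_mem_cellN_W`, `cellOfR_injOn_W`, **`realisedReadingRW_of_domainsRW`**,
**`realisedReadingW_of_domainsW_of_le`**, `realisedReadingW_of_domainsW`.  §3 **`realisedReadingRW_of_domainsRunW`** (at
the run's own profile `runProfile F.L R`, no profile side condition displayed).  [folklore] two hypothesis SHAPES (twins;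
no `Prop` FACT of print minted) + junction lemmas; nothing printed asserted, no `[cite:]`, zero `sorry`.

HONEST.  Index-model geometry and torus bookkeeping on OUR carriers; the reading H3^NE7b (`real`, `track`, `disjoint`,
`inBox` — now in memory-agnostic form), (B) and the BetaPertH-flow facts stay DISPLAYED; by-name class of every
`WALL-NE7b-P1.md` §2 binder UNCHANGED; headline p224237 UNCHANGED BY NAME until S12-W re-plugs; located open point G-M4-1
(touch-connected births) untouched; NE7b NOT proved; spine 0∕9.  HONEST DEPENDENCY (cell): continuum YM on T⁴ ⇐
BetaPertH ∧ nine spine estimates (0/9 proved); BetaPertH ⇐ (D1) ∧ (D4) ∧ CAP+tail; G-an2-4 gates asym, D1 and NE2/3/4.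
This file changes none of it. -/

open Finset
open Literature.MathematicalPhysics.QuantumFieldTheory.Balaban1983to89
open Literature.MathematicalPhysics.QuantumFieldTheory.Balaban1983to89.B13ScaleTransfer
open Literature.MathematicalPhysics.QuantumFieldTheory.Balaban1983to89.B16SProfile
open Literature.MathematicalPhysics.QuantumFieldTheory.Balaban1983to89.B16MergeHorizon
open T4PersistenceDictionary
open Summit.QuantumFields.BalabanUV.T4Continuum.HistoryTables
open Summit.QuantumFields.BalabanUV.T4Continuum.HistoryGen
open Summit.QuantumFields.BalabanUV.T4Continuum.ZoneTorus
open Summit.QuantumFields.BalabanUV.T4Continuum.HistoryZones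
open Summit.QuantumFields.BalabanUV.T4Continuum.HistoryAdmissible
open Summit.QuantumFields.BalabanUV.T4Continuum.HistoryAssemblyRealiseLE
open Summit.QuantumFields.BalabanUV.T4Continuum.HistoryRealise
open Summit.QuantumFields.BalabanUV.T4Continuum.HistoryRealisePrint
open Summit.QuantumFields.BalabanUV.T4Continuum.HistoryRealisePrintReading
open Summit.QuantumFields.BalabanUV.T4Continuum.HistoryRealiseWeak
open Summit.QuantumFields.BalabanUV.T4Continuum.HistoryRealiseWeakReading
open Summit.QuantumFields.BalabanUV.T4Continuum.HistoryRealisePrintCells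
open Summit.QuantumFields.BalabanUV.T4Continuum.HistoryRealiseCells
open Summit.QuantumFields.BalabanUV.T4Continuum.HistoryRealiseCellsRun
open Summit.QuantumFields.BalabanUV.T4Continuum.HistoryFlow
open Summit.QuantumFields.BalabanUV.T4Continuum.HistoryAssemblyRealiseRun
open T4Continuum

namespace Summit.QuantumFields.BalabanUV.T4Continuum.HistoryRealiseWeakCells

noncomputable section

variable {d : ℕ}

/-! ## §1 The memory-agnostic domain carriers -/

section Reading

variable {ι α π : Type*} [DecidableEq α]

/-- **THE PER-TERM READING AS WEAKLY REALISED PENDING PEDIGREES WITH THEIR DOMAINS** (twin of leaf-08's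
`HistoryRealiseCells.RealisedDomains` and `HistoryRealisePrintCells.RealisedDomainsP`, hypothesis SHAPE): for every cutoff
`K ≥ K₀` and term `τ ∈ T K`, the encoding facts `renew_step`∕`forest`∕`headOldest`; for every live component `c` with
region history `P := (ped K τ).toPGen (cellP K τ) c` and last-event domain `Z K τ c`: `real` — `P` is `RealisesW`-realised
by `Z K τ c` (renewals: condition (i) at the readiness index + frozen pendency strictly before it, NO readiness
convention) and pending STRICTLY BEFORE `K` (`PendingBefore`); `track`, `disjoint`, `inBox` verbatim. [folklore] -/
structure RealisedDomainsW (L : ℕ) (s : ℕ → ℕ) (n K₀ : ℕ) (R : ℕ → ℕ → ℕ) (T : ℕ → Finset ι)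
    (ped : ℕ → ι → Pedigree α π) (cellP : ℕ → ι → π → Pt d × Finset (Pt d)) (liveC : ℕ → ι → Finset α)
    (Z : ℕ → ι → α → Finset (Pt d)) : Prop where
  /-- encoding: a renewal is dated one step after the renewed part -/
  renew_step : ∀ K, K₀ ≤ K → ∀ τ ∈ T K, ∀ c c', Part.old c' true ∈ (ped K τ).parts c →
    (ped K τ).step c' + 1 = (ped K τ).step c
  /-- the pedigree is a forest -/
  forest : ∀ K, K₀ ≤ K → ∀ τ ∈ T K, ∀ c, (ped K τ).Forest c
  /-- oldest line first at every component -/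
  headOldest : ∀ K, K₀ ≤ K → ∀ τ ∈ T K, ∀ c, (ped K τ).HeadOldest c
  /-- every live component is weakly realised by its domain and pending strictly before the cutoff -/
  real : ∀ K, K₀ ≤ K → ∀ τ ∈ T K, ∀ c ∈ liveC K τ,
    RealisesW L s (R K) ((ped K τ).toPGen (cellP K τ) c) (Z K τ c) ∧
      PendingBefore L s (R K) ((ped K τ).toPGen (cellP K τ) c).lastStep (Z K τ c) K
  /-- the domain contains the re-blocked anchor cube of the first-born constituent -/
  track : ∀ K, K₀ ≤ K → ∀ τ ∈ T K, ∀ c ∈ liveC K τ,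
    anchorAt L s ((ped K τ).toPGen (cellP K τ) c) ((ped K τ).toPGen (cellP K τ) c).lastStep ∈ Z K τ c
  /-- distinct live components of one term have disjoint current domains at the cutoff -/
  disjoint : ∀ K, K₀ ≤ K → ∀ τ ∈ T K, ∀ c ∈ liveC K τ, ∀ c' ∈ liveC K τ, c ≠ c' →
    Disjoint (curDomain L s ((ped K τ).toPGen (cellP K τ) c) (Z K τ c) K)
      (curDomain L s ((ped K τ).toPGen (cellP K τ) c') (Z K τ c') K)
  /-- root anchors lie in the period box at the model scale of their birth step -/
  inBox : ∀ K, K₀ ≤ K → ∀ τ ∈ T K, ∀ c ∈ liveC K τ, ∀ i,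
    0 ≤ rootAnchor ((ped K τ).toPGen (cellP K τ) c) i ∧
      L ^ levelOf s K ((ped K τ).toPGen (cellP K τ) c).rootStep *
        (rootAnchor ((ped K τ).toPGen (cellP K τ) c) i).toNat < n * L ^ K

/-- **THE SAME PER RUN** (twin of leaf-08's `HistoryRealiseCellsRun.RealisedDomainsR` ∕ `HistoryRealisePrintCells.
RealisedDomainsRP`, hypothesis SHAPE): the exponent profile `s K` of the run with cutoff `K` in every field. [folklore] -/
structure RealisedDomainsRW (L : ℕ) (s : ℕ → ℕ → ℕ) (n K₀ : ℕ) (R : ℕ → ℕ → ℕ) (T : ℕ → Finset ι)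
    (ped : ℕ → ι → Pedigree α π) (cellP : ℕ → ι → π → Pt d × Finset (Pt d)) (liveC : ℕ → ι → Finset α)
    (Z : ℕ → ι → α → Finset (Pt d)) : Prop where
  /-- encoding: a renewal is dated one step after the renewed part -/
  renew_step : ∀ K, K₀ ≤ K → ∀ τ ∈ T K, ∀ c c', Part.old c' true ∈ (ped K τ).parts c →
    (ped K τ).step c' + 1 = (ped K τ).step c
  /-- the pedigree is a forest -/
  forest : ∀ K, K₀ ≤ K → ∀ τ ∈ T K, ∀ c, (ped K τ).Forest c
  /-- oldest line first at every component -/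
  headOldest : ∀ K, K₀ ≤ K → ∀ τ ∈ T K, ∀ c, (ped K τ).HeadOldest c
  /-- every live component is weakly realised along the run's blockings and pending strictly before the cutoff -/
  real : ∀ K, K₀ ≤ K → ∀ τ ∈ T K, ∀ c ∈ liveC K τ,
    RealisesW L (s K) (R K) ((ped K τ).toPGen (cellP K τ) c) (Z K τ c) ∧
      PendingBefore L (s K) (R K) ((ped K τ).toPGen (cellP K τ) c).lastStep (Z K τ c) K
  /-- the domain contains the re-blocked anchor cube of the first-born constituent -/
  track : ∀ K, K₀ ≤ K → ∀ τ ∈ T K, ∀ c ∈ liveC K τ,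
    anchorAt L (s K) ((ped K τ).toPGen (cellP K τ) c) ((ped K τ).toPGen (cellP K τ) c).lastStep ∈ Z K τ c
  /-- distinct live components of one term have disjoint current domains at the cutoff -/
  disjoint : ∀ K, K₀ ≤ K → ∀ τ ∈ T K, ∀ c ∈ liveC K τ, ∀ c' ∈ liveC K τ, c ≠ c' →
    Disjoint (curDomain L (s K) ((ped K τ).toPGen (cellP K τ) c) (Z K τ c) K)
      (curDomain L (s K) ((ped K τ).toPGen (cellP K τ) c') (Z K τ c') K)
  /-- root anchors lie in the period box at the model scale of their birth step in the run -/
  inBox : ∀ K, K₀ ≤ K → ∀ τ ∈ T K, ∀ c ∈ liveC K τ, ∀ i,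
    0 ≤ rootAnchor ((ped K τ).toPGen (cellP K τ) c) i ∧
      L ^ levelOf (s K) K ((ped K τ).toPGen (cellP K τ) c).rootStep *
        (rootAnchor ((ped K τ).toPGen (cellP K τ) c) i).toNat < n * L ^ K

variable {L : ℕ} {n K₀ : ℕ} {R : ℕ → ℕ → ℕ} {T : ℕ → Finset ι} {ped : ℕ → ι → Pedigree α π}
  {cellP : ℕ → ι → π → Pt d × Finset (Pt d)} {liveC : ℕ → ι → Finset α} {Z : ℕ → ι → α → Finset (Pt d)}

/-- **THE PRINT-EXACT DOMAIN READING IMPLIES THE MEMORY-AGNOSTIC ONE** (`realisesW_of_realisesP`). [folklore] -/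
theorem RealisedDomainsP.toW {sP : ℕ → ℕ} (H : RealisedDomainsP L sP n K₀ R T ped cellP liveC Z) :
    RealisedDomainsW L sP n K₀ R T ped cellP liveC Z where
  renew_step := H.renew_step
  forest := H.forest
  headOldest := H.headOldest
  real K hK τ hτ c hc := ⟨realisesW_of_realisesP _ _ (H.real K hK τ hτ c hc).1, (H.real K hK τ hτ c hc).2⟩
  track := H.track
  disjoint := H.disjoint
  inBox := H.inBox

/-- **THE LANDED DOMAIN READING IMPLIES THE MEMORY-AGNOSTIC ONE** (`realisesW_of_realises`, `pendingBefore_of_pendingAt`).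
[folklore] -/
theorem RealisedDomains.toW {sP : ℕ → ℕ} (H : RealisedDomains L sP n K₀ R T ped cellP liveC Z) :
    RealisedDomainsW L sP n K₀ R T ped cellP liveC Z where
  renew_step := H.renew_step
  forest := H.forest
  headOldest := H.headOldest
  real K hK τ hτ c hc :=
    ⟨realisesW_of_realises _ _ (H.real K hK τ hτ c hc).1, pendingBefore_of_pendingAt (H.real K hK τ hτ c hc).2⟩
  track := H.track
  disjoint := H.disjoint
  inBox := H.inBox

/-- **THE PRINT-EXACT PER-RUN DOMAIN READING IMPLIES THE MEMORY-AGNOSTIC ONE.** [folklore] -/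
theorem RealisedDomainsRP.toW {s : ℕ → ℕ → ℕ} (H : RealisedDomainsRP L s n K₀ R T ped cellP liveC Z) :
    RealisedDomainsRW L s n K₀ R T ped cellP liveC Z where
  renew_step := H.renew_step
  forest := H.forest
  headOldest := H.headOldest
  real K hK τ hτ c hc := ⟨realisesW_of_realisesP _ _ (H.real K hK τ hτ c hc).1, (H.real K hK τ hτ c hc).2⟩
  track := H.track
  disjoint := H.disjoint
  inBox := H.inBox

/-- **THE LANDED PER-RUN DOMAIN READING IMPLIES THE MEMORY-AGNOSTIC ONE.** [folklore] -/
theorem RealisedDomainsR.toW {s : ℕ → ℕ → ℕ} (H : RealisedDomainsR L s n K₀ R T ped cellP liveC Z) :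
    RealisedDomainsRW L s n K₀ R T ped cellP liveC Z where
  renew_step := H.renew_step
  forest := H.forest
  headOldest := H.headOldest
  real K hK τ hτ c hc :=
    ⟨realisesW_of_realises _ _ (H.real K hK τ hτ c hc).1, pendingBefore_of_pendingAt (H.real K hK τ hτ c hc).2⟩
  track := H.track
  disjoint := H.disjoint
  inBox := H.inBox

/-- the constant-profile junction (memory-agnostic form) [folklore] -/
theorem RealisedDomainsRW.of_const {sP : ℕ → ℕ} (H : RealisedDomainsW L sP n K₀ R T ped cellP liveC Z) :
    RealisedDomainsRW L (fun _ => sP) n K₀ R T ped cellP liveC Z :=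
  ⟨H.renew_step, H.forest, H.headOldest, H.real, H.track, H.disjoint, H.inBox⟩

/-- … and conversely [folklore] -/
theorem RealisedDomainsRW.to_const {sP : ℕ → ℕ} (H : RealisedDomainsRW L (fun _ => sP) n K₀ R T ped cellP liveC Z) :
    RealisedDomainsW L sP n K₀ R T ped cellP liveC Z :=
  ⟨H.renew_step, H.forest, H.headOldest, H.real, H.track, H.disjoint, H.inBox⟩

/-- a weakly realised history pending strictly before `K` has `rootStep ≤ lastStep ≤ K` [folklore] -/
theorem rootStep_le_of_realW {s : ℕ → ℕ} {P : PGen (Pt d × Finset (Pt d))} {ZP : Finset (Pt d)} {K : ℕ}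
    (h : RealisesW L s (R K) P ZP ∧ PendingBefore L s (R K) P.lastStep ZP K) :
    P.rootStep ≤ P.lastStep ∧ P.lastStep ≤ K :=
  ⟨(adm_of_realisesW P ZP h.1 h.2.1).rootStep_le_lastStep, h.2.1⟩

/-! ## §2 The two root-cell fields discharged, memory-agnostic form -/

/-- **FIELD `cell_mem` PER RUN**, memory-agnostic form (proof verbatim: only `rootStep ≤ lastStep ≤ K` of `real` is
used). [folklore] -/
theorem cellOfR_mem_cellN_W {s : ℕ → ℕ → ℕ} (hL : 0 < L) (hn : 0 < n)
    (H : RealisedDomainsRW L s n K₀ R T ped cellP liveC Z) {K : ℕ} (hK : K₀ ≤ K)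
    (hs : ∀ t, t < K → s K (t + 1) ≤ s K t) (hdrop : DropCtl (s K) K) {τ : ι} (hτ : τ ∈ T K) {c : α}
    (hc : c ∈ liveC K τ) : cellOfR n L s ped cellP K τ c ∈ cellN d n L K (K - ((ped K τ).genT c).rootStep) := by
  obtain ⟨hjt, htK⟩ := rootStep_le_of_realW (H.real K hK τ hτ c hc)
  have hjK := hjt.trans htK
  rw [← Pedigree.rootStep_toPGen (ped K τ) (cellP K τ) (H.renew_step K hK τ hτ) c]
  exact cornerCell_mem_cellN (mul_pos hn (pow_pos hL K)) (le_levelOf hs _)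
    ((levelFn_levelOf hs hdrop).le_K _ hjK) _

/-- **FIELD `cell_inj` PER RUN**, memory-agnostic form (proof verbatim: equal corners force nested anchor cubes, both
current domains contain the re-blocked older anchor by `track`, contradicting `disjoint`). [folklore] -/
theorem cellOfR_injOn_W {s : ℕ → ℕ → ℕ} (hL : 0 < L) (H : RealisedDomainsRW L s n K₀ R T ped cellP liveC Z) {K : ℕ}
    (hK : K₀ ≤ K) (hs : ∀ t, t < K → s K (t + 1) ≤ s K t) (hdrop : DropCtl (s K) K) {τ : ι} (hτ : τ ∈ T K) :
    Set.InjOn (cellOfR n L s ped cellP K τ) (liveC K τ : Set α) := by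
  have hLF := levelFn_levelOf hs hdrop
  have key : ∀ c ∈ liveC K τ, ∀ c' ∈ liveC K τ,
      ((ped K τ).toPGen (cellP K τ) c).rootStep ≤ ((ped K τ).toPGen (cellP K τ) c').rootStep →
      cellOfR n L s ped cellP K τ c = cellOfR n L s ped cellP K τ c' → c = c' := by
    intro c hc c' hc' hjj heq
    by_contra hne
    set P := (ped K τ).toPGen (cellP K τ) c with hP
    set P' := (ped K τ).toPGen (cellP K τ) c' with hP'
    obtain ⟨hjt, htK⟩ := rootStep_le_of_realW (H.real K hK τ hτ c hc)
    obtain ⟨hjt', htK'⟩ := rootStep_le_of_realW (H.real K hK τ hτ c' hc')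
    have hj'K : P'.rootStep ≤ K := hjt'.trans htK'
    have hnest : coarse (L ^ (levelOf (s K) K P'.rootStep - levelOf (s K) K P.rootStep)) (rootAnchor P) =
        rootAnchor P' :=
      coarse_eq_of_cornerCell_eq hL (H.inBox K hK τ hτ c hc) (H.inBox K hK τ hτ c' hc') (hLF.monotone hjj) heq
    rw [← Qfrom_eq_pow_levelOf_sub_of_le hL hs hdrop hjj hj'K] at hnest
    have hAA : anchorAt L (s K) P K = anchorAt L (s K) P' K := by
      rw [← coarse_anchorAt L (s K) P hjj hj'K]
      unfold anchorAt
      rw [hnest]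
    have hm : anchorAt L (s K) P K ∈ curDomain L (s K) P (Z K τ c) K :=
      anchorAt_mem_curDomain L (s K) (H.track K hK τ hτ c hc) hjt htK
    have hm' : anchorAt L (s K) P' K ∈ curDomain L (s K) P' (Z K τ c') K :=
      anchorAt_mem_curDomain L (s K) (H.track K hK τ hτ c' hc') hjt' htK'
    rw [hAA] at hm
    exact Finset.disjoint_left.1 (H.disjoint K hK τ hτ c hc c' hc' hne) hm hm'
  intro c hc c' hc' heq
  rcases le_total ((ped K τ).toPGen (cellP K τ) c).rootStep ((ped K τ).toPGen (cellP K τ) c').rootStep with h | h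
  · exact key c (Finset.mem_coe.1 hc) c' (Finset.mem_coe.1 hc') h heq
  · exact (key c' (Finset.mem_coe.1 hc') c (Finset.mem_coe.1 hc) h heq.symm).symm

/-- **THE PER-RUN MEMORY-AGNOSTIC READING FROM DOMAINS**: file 2's `RealisedReadingRW` for the DEFINED root-cell map
`cellOfR`, both cell fields PROVED, under the within-run side conditions `DropCtl (s K) K`, `∀ t < K, s K (t+1) ≤ s K t`
per cutoff (`L, n ≥ 1`). [folklore] -/
theorem realisedReadingRW_of_domainsRW {s : ℕ → ℕ → ℕ} (hL : 0 < L) (hn : 0 < n)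
    (hs : ∀ K, K₀ ≤ K → ∀ t, t < K → s K (t + 1) ≤ s K t) (hdrop : ∀ K, K₀ ≤ K → DropCtl (s K) K)
    (H : RealisedDomainsRW L s n K₀ R T ped cellP liveC Z) :
    RealisedReadingRW L s (cellN d n L) K₀ R T ped cellP liveC (cellOfR n L s ped cellP) where
  renew_step := H.renew_step
  forest := H.forest
  headOldest := H.headOldest
  real K hK τ hτ c hc := ⟨Z K τ c, H.real K hK τ hτ c hc⟩
  cell_mem K hK _ hτ _ hc := cellOfR_mem_cellN_W hL hn H hK (hs K hK) (hdrop K hK) hτ hc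
  cell_inj K hK _ hτ := cellOfR_injOn_W hL H hK (hs K hK) (hdrop K hK) hτ

/-- **THE CONSTANT-PROFILE MEMORY-AGNOSTIC READING FROM DOMAINS**, within-run side conditions (the sharp form).
[folklore] -/
theorem realisedReadingW_of_domainsW_of_le {sP : ℕ → ℕ} (hL : 0 < L) (hn : 0 < n)
    (hs : ∀ K, K₀ ≤ K → ∀ t, t < K → sP (t + 1) ≤ sP t) (hdrop : ∀ K, K₀ ≤ K → DropCtl sP K)
    (H : RealisedDomainsW L sP n K₀ R T ped cellP liveC Z) :
    RealisedReadingW L sP (cellN d n L) K₀ R T ped cellP liveC (cellOfA n L sP ped cellP) where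
  renew_step := H.renew_step
  forest := H.forest
  headOldest := H.headOldest
  real K hK τ hτ c hc := ⟨Z K τ c, H.real K hK τ hτ c hc⟩
  cell_mem K hK _ hτ _ hc :=
    cellOfR_mem_cellN_W hL hn (RealisedDomainsRW.of_const H) hK (hs K hK) (hdrop K hK) hτ hc
  cell_inj K hK _ hτ := cellOfR_injOn_W hL (RealisedDomainsRW.of_const H) hK (hs K hK) (hdrop K hK) hτ

/-- **THE CONSTANT-PROFILE MEMORY-AGNOSTIC READING FROM DOMAINS**, global side conditions (twin of
`HistoryRealiseCells.realisedReading_of_domains`: `L, n ≥ 1`, stepwise non-increasing drop-controlled exponents).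
[folklore] -/
theorem realisedReadingW_of_domainsW {sP : ℕ → ℕ} (hL : 0 < L) (hn : 0 < n) (hs : ∀ t, sP (t + 1) ≤ sP t)
    (hdrop : ∀ m, DropCtl sP m) (H : RealisedDomainsW L sP n K₀ R T ped cellP liveC Z) :
    RealisedReadingW L sP (cellN d n L) K₀ R T ped cellP liveC (cellOfA n L sP ped cellP) :=
  realisedReadingW_of_domainsW_of_le hL hn (fun _ _ t _ => hs t) (fun K _ => hdrop K) H

end Reading

/-! ## §3 At the run's own profile: both side conditions from the flow -/

section Run

variable {F : T4Family} {G : Type*} [GaugeGroup G] [MeasurableSpace G] [HaarData G]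
variable {ι α π : Type*} [DecidableEq α] {n K₀ : ℕ} {T : ℕ → Finset ι} {ped : ℕ → ι → Pedigree α π}
  {cellP : ℕ → ι → π → Pt d × Finset (Pt d)} {liveC : ℕ → ι → Finset α} {Z : ℕ → ι → α → Finset (Pt d)}

/-- **THE MEMORY-AGNOSTIC BRIDGE AT THE RUN'S OWN PROFILE, NO PROFILE SIDE CONDITION DISPLAYED**: for the reading
realised along `runProfile F.L R`, file 2's `RealisedReadingRW` with root cells `cellOfR` follows from `RealisedDomainsRW`
ALONE on the geometric side (drop control by `dropCtl_runProfile`, monotonicity by `runProfile_succ_le`, both from the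
flow; `0 < n`). [folklore] -/
theorem realisedReadingRW_of_domainsRunW (D : FiniteEpsData F G) {γ₀ γb b β' β₀ : ℝ} {pe rr : ℕ} (hb : 0 ≤ b)
    (hlo : FlowStep.BetaLowerH b γ₀ D.βfun) (hhi : FlowStep.BetaUpperH β' γ₀ D.βfun) (hγ : γb ≤ γ₀)
    (hγβ : γb ^ 2 * β' < 1) (S : B14FlowStep.SmallnessFor γb β' β₀ F.L pe) (hrr : rr ≤ pe) (hβ : β₀ ≤ 1 / 2)
    {g : ℝ} {g₀ : ℕ → ℝ} (ht : D.Tuned γb g g₀) (R : ℕ → ℕ → ℕ)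
    (hR : ∀ K s, s ≤ K → B14.IsRj F.L rr ((D.C ⟨K, F.m, g₀ K⟩).flow.g s) (R K s)) (hn : 0 < n)
    (H : RealisedDomainsRW F.L (runProfile F.L R) n K₀ R T ped cellP liveC Z) :
    RealisedReadingRW F.L (runProfile F.L R) (cellN d n F.L) K₀ R T ped cellP liveC
      (cellOfR n F.L (runProfile F.L R) ped cellP) :=
  realisedReadingRW_of_domainsRW (lt_of_lt_of_le (by norm_num) (two_le_L F)) hn
    (fun K _ => runProfile_succ_le D hb hlo hhi hγ hγβ S ht R hR K)
    (fun K _ => dropCtl_runProfile D hb hlo hhi hγ hγβ S hrr hβ ht R hR K K) H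

end Run

end

end Summit.QuantumFields.BalabanUV.T4Continuum.HistoryRealiseWeakCells
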